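import Literature.NumberTheory.EllipticCurves.ZpExtensionEisensteinOrdinaryResidualLiftProofs
import Literature.NumberTheory.EllipticCurves.TorsionFilAtCountMultiplicativeThreeProofs
import HarnessLib

/-!
# Purity of `A ⊗ Fil_w` under `π̄` at a place `w ∣ 3` of MULTIPLICATIVE reduction (theorems only — no definition, no named fact, no
# instance, no `sorry`)

Topic `NumberTheory/EllipticCurves` (LEAD `bsd-wall-utd-p1`, crux r205 stmt-BirchSwinnertonDyer-24737 `TwinAlgMuZeroAtThree`,
line `beta-road`, stub `stub_howardOutputsOfFamily`, E2 assembly at `v ∣ 3`).  x9/x10b's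
`ZpExtensionEisensteinOrdinaryResidualLiftProofs.exists_eq_mk_X_smul_of_πbar_eq_zero` (purity at the bottom level, the input of
`…OrdinaryResidualLiftSurjectiveProofs`) assumes GOOD reduction with an ordinary point, used only through the adapted basis; at places
of MULTIPLICATIVE reduction above `3` the basis is
`TorsionFilAtCountMultiplicativeThreeProofs.exists_addEquiv_mem_torsionFilAt_iff_of_hasMultiplicativeReductionAt_three`.  This file:
the statement and proof at `p = 3` with `(hgood, hord)` replaced by `hmult` (§1 and §3 of x9's file are generic and imported).
BSD is not proved by any of this.

References: [Howard2004HeegnerKolyvagin] §3.1, Rem. 1.1.4; [GreenbergLNM1716] §2 p. 82.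
-/

set_option autoImplicit false

noncomputable section

open Function NumberField IsDedekindDomain Field
open scoped NumberField TensorProduct ContRepresentation

namespace WeierstrassCurve

open Literature.NumberTheory.EllipticCurves Literature.NumberTheory.GaloisRepresentations
open Literature.NumberTheory.GaloisRepresentations.DiscreteGaloisModule
open Literature.NumberTheory.GaloisCohomology.Howard2004
open Literature.NumberTheory.EllipticCurves.IwasawaAlgebra Literature.NumberTheory.EllipticCurves.ZpExtension
open Literature.NumberTheory.Automorphic

variable {K : Type} [Field K] [NumberField K] (E : WeierstrassCurve K) [E.IsElliptic]
  (κ : ZpExtension K 3) {m : ℕ} (hm : 1 ≤ m) (w : HeightOneSpectrum (𝓞 K))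
  [Module (EisensteinCoeff 3 m 1) (geomTorsion E ((3 : ℕ) : ℤ))]
  (hN : ∀ (d : EisensteinCoeff 3 m 1) (n : geomTorsion E ((3 : ℕ) : ℤ)), d • n = (EisensteinCoeff.residueChar 3 hm (le_refl 1) d).val • n)
  (πbar : EisensteinCoeff.Twisted 3 m 1 (geomTorsion E (((3 : ℕ) : ℤ) ^ 1)) →ₗ[EisensteinCoeff 3 m 1] geomTorsion E ((3 : ℕ) : ℤ))
  (hbar : IsQuotientBy (κ.eisensteinTwist (E.torsionGaloisModule (((3 : ℕ) : ℤ) ^ 1)) hm 1)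
    (@IsLocalRing.maximalIdeal _ _ (EisensteinCoeff.isLocalRing_eisensteinCoeff 3 hm (le_refl 1)))
    (E.torsionGaloisModule ((3 : ℕ) : ℤ)) πbar)
  (hone : ∀ a : geomTorsion E (((3 : ℕ) : ℤ) ^ 1),
    ((πbar (EisensteinCoeff.Twisted.tmul 1 a) : geomTorsion E ((3 : ℕ) : ℤ)) : geomPoints E) = (a : geomPoints E))


/-! ## Purity `ker π̄ ∩ (A ⊗ Fil) = [T]·(A ⊗ Fil)` in the adapted basis, at a MULTIPLICATIVE `w ∣ 3` -/

include hbar in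
/-- **Purity at the bottom level.**  At a place `w ∋ p` of good reduction with an ordinary point: if `x ∈ A_{m,1} ⊗ Fil_w E[p]` and
`π̄ x = 0` then `x = [T] • y` with `y ∈ A_{m,1} ⊗ Fil_w E[p]`.  In the `A_{m,1}`-basis `1 ⊗ e⁻¹(δ₀), 1 ⊗ e⁻¹(δ₁)` of `W₁` attached to
an adapted `e : E[p] ≃ (ℤ/p)²` (`Fil = {e · 1 = 0}`), `A ⊗ Fil` is `{repr · 1 = 0}` and `ker π̄ = [T] W₁`.
[cite: Howard2004HeegnerKolyvagin, §3.1 and Rem. 1.1.4 (arXiv:1202.6340 p. 15 L56–66)] [cite: GreenbergLNM1716, §2 p. 82] -/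
theorem exists_eq_mk_X_smul_of_πbar_eq_zero_of_hasMultiplicativeReductionAt_three (hpw : ((3 : ℕ) : 𝓞 K) ∈ w.asIdeal)
    (hmult : E.HasMultiplicativeReductionAt w)
    {x : EisensteinCoeff.Twisted 3 m 1 (geomTorsion E (((3 : ℕ) : ℤ) ^ 1))}
    (hx : x ∈ (E.ordinaryFiltrationAt w (fun j ↦ E.torsionGaloisModuleReduce 3 j) (fun _ _ ↦ rfl)).twistedFil
      (p := 3) (m := m) 1) (hx0 : πbar x = 0) :
    ∃ y ∈ (E.ordinaryFiltrationAt w (fun j ↦ E.torsionGaloisModuleReduce 3 j) (fun _ _ ↦ rfl)).twistedFil (p := 3) (m := m) 1,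
      x = (Ideal.Quotient.mk _ PowerSeries.X : EisensteinCoeff 3 m 1) • y := by
  set Φ := E.ordinaryFiltrationAt w (fun j ↦ E.torsionGaloisModuleReduce 3 j) (fun _ _ ↦ rfl) with hΦ
  set Tbar : EisensteinCoeff 3 m 1 := Ideal.Quotient.mk _ PowerSeries.X with hTbar
  obtain ⟨e, he⟩ := E.exists_addEquiv_mem_torsionFilAt_iff_of_hasMultiplicativeReductionAt_three w hpw hmult (j := 1) le_rfl
  let b := EisensteinCoeff.Twisted.basisOfAddEquiv (m := m) e
  -- `A ⊗ Fil ⊆ {repr · 1 = 0}`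
  have hrepr1 : ∀ z ∈ Φ.twistedFil (p := 3) (m := m) 1, b.repr z 1 = 0 := by
    intro z hz
    induction hz using Submodule.span_induction with
    | mem y hy =>
      obtain ⟨c, a, ha, rfl⟩ := hy
      rw [EisensteinCoeff.Twisted.basisOfAddEquiv_repr_tmul, (he a).mp ha, ZMod.cast_zero, mul_zero]
    | zero => rw [map_zero, Finsupp.zero_apply]
    | add y z _ _ hy hz => rw [map_add, Finsupp.add_apply, hy, hz, add_zero]
    | smul n y _ hy =>
      rw [map_zsmul]
      change n • b.repr y 1 = 0
      rw [hy]
      exact zsmul_zero n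
  -- `b 0 ∈ A ⊗ Fil`
  have hb0 : ∀ c : EisensteinCoeff 3 m 1, c • b 0 ∈ Φ.twistedFil (p := 3) (m := m) 1 := by
    intro c
    change c • EisensteinCoeff.Twisted.basisOfAddEquiv (m := m) e 0 ∈ _
    rw [EisensteinCoeff.Twisted.basisOfAddEquiv_apply, EisensteinCoeff.Twisted.smul_tmul, mul_one]
    refine Φ.tmul_mem_twistedFil 1 _ ((he _).mpr ?_)
    rw [AddEquiv.apply_symm_apply, Pi.single_eq_of_ne (by decide)]
  -- decomposition in the basis
  have hsum : ∀ z : EisensteinCoeff.Twisted 3 m 1 (geomTorsion E (((3 : ℕ) : ℤ) ^ 1)), b.repr z 0 • b 0 + b.repr z 1 • b 1 = z := by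
    intro z
    have h := b.sum_repr z
    rwa [Fin.sum_univ_two] at h
  -- `π̄ x = 0 ⇒ x = [T] • z`
  letI := EisensteinCoeff.isLocalRing_eisensteinCoeff 3 hm (le_refl 1)
  have hxker : x ∈ LinearMap.ker πbar := hx0
  rw [hbar.ker_eq, EisensteinCoeff.maximalIdeal_eisensteinCoeff_eq 3 hm (le_refl 1), Submodule.ideal_span_singleton_smul] at hxker
  obtain ⟨z, -, rfl⟩ := (Submodule.mem_smul_pointwise_iff_exists _ _ _).mp hxker
  refine ⟨b.repr z 0 • b 0, hb0 _, ?_⟩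
  have hx1 : Tbar * b.repr z 1 = 0 := by
    have h := hrepr1 _ hx
    rwa [LinearEquiv.map_smul, Finsupp.smul_apply, smul_eq_mul] at h
  calc Tbar • z = Tbar • (b.repr z 0 • b 0 + b.repr z 1 • b 1) := by rw [hsum]
    _ = (Tbar * b.repr z 0) • b 0 + (Tbar * b.repr z 1) • b 1 := by rw [smul_add, smul_smul, smul_smul]
    _ = Tbar • (b.repr z 0 • b 0) := by rw [hx1, zero_smul, add_zero, smul_smul]

end WeierstrassCurve

end
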